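import Summits.HodgeConjecture.CorCM.TwoGroupCaseARawBits
import Summits.HodgeConjecture.CorCM.TwoGroupCaseAReduceId
import Summits.HodgeConjecture.CorCM.TwoGroupCaseAReduceSwap
import HarnessLib

/-!
# Case A of the order-`32` base: the normal form of family CA2 (`C(t)/N ≅ C₂²`)

COR-CM (cell `pub-hodgecm2`), binder seat b04 (gen 37), count-neutral own lane «Galois-CM-type classification».  KERNEL ONLY:
theorems; no definition, no named fact, no `sorry`.  Pure group theory (A7-JUNCTION gen-36 addendum §G (b), gen-37 addendum).
`|G| = 32`, `c ≠ 1` a central involution, `t ∉ {1, c}` an involution with `x t x⁻¹ = tc` and all conjugates in `{t, tc}`, every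
element of `M = C(t)` squaring into `N = {1, t, c, tc}`.  Choosing `a ∈ M ∖ N` with `x² ∈ N ∪ Na` and `b ∈ M ∖ N⟨a⟩`, the
eighteen raw bits (`CorCM/TwoGroupCaseARawBits`) have `e₆ = 0`; if `θ̄ = id` on `M/N` they reduce to family CA2-Id
(`id_reduce`), otherwise — after replacing the basis by `a', x a' x⁻¹` for an `a' ∈ {a, b}` moved by `θ̄` — to family CA2-Swap
(`swap_reduce`): `pair_normal_form`, whose two alternatives are exactly the hypotheses of `exists_simple_degenerate_of_ca2_id`
and `exists_simple_degenerate_of_ca2_swap`.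

## References

* [Rotman1995] J. J. Rotman, *An Introduction to the Theory of Groups*, 4th ed., GTM 148, Ch. 5 and Ch. 7 (extensions).
-/

namespace Summit.HodgeConjecture.CorCM.GaloisModels.CaseA

open Summit.HodgeConjecture.CorCM.GaloisTableLaws (zmod2_cases)

variable {G : Type*} [Group G]

/-! ## §1 `N` is stable under conjugation by `x` -/

/-- `x⁻¹ (tᵖ c^q) x` is again a word `t^{p} c^{q'}`. [folklore] -/
theorem conj_inv_word {t c x : G} (hcc : c * c = 1) (hcen : ∀ g : G, c * g = g * c)
    (hconj : ∀ g : G, g * t * g⁻¹ = t ∨ g * t * g⁻¹ = t * c) (p q : ZMod 2) :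
    ∃ q' : ZMod 2, x⁻¹ * (t ^ p.val * c ^ q.val) * x = t ^ p.val * c ^ q'.val := by
  have hxc : x⁻¹ * c * x = c := by rw [mul_assoc, hcen x, ← mul_assoc, inv_mul_cancel, one_mul]
  have key : ∀ s : G, x⁻¹ * t * x = s → x⁻¹ * (t ^ p.val * c ^ q.val) * x = s ^ p.val * c ^ q.val := by
    intro s hs
    rw [show x⁻¹ * (t ^ p.val * c ^ q.val) * x = (x⁻¹ * t * x⁻¹⁻¹) ^ p.val * (x⁻¹ * c * x⁻¹⁻¹) ^ q.val by
      rw [conj_pow, conj_pow]; group, inv_inv, hs, hxc]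
  rcases hconj x⁻¹ with h | h <;> rw [inv_inv] at h
  · exact ⟨q, key t h⟩
  · refine ⟨p + q, ?_⟩
    rw [key (t * c) h, (show Commute t c from (hcen t).symm).mul_pow, mul_assoc, ← FrattiniTwo.invol_pow_add hcc]

/-- If `g ∉ N` then `x g x⁻¹ ∉ N` (contrapositive form on words). [folklore] -/
theorem conj_not_word {t c x g : G} (hcc : c * c = 1) (hcen : ∀ h : G, c * h = h * c)
    (hconj : ∀ h : G, h * t * h⁻¹ = t ∨ h * t * h⁻¹ = t * c) (hg : ∀ p q : ZMod 2, g ≠ t ^ p.val * c ^ q.val)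
    (p q : ZMod 2) : x * g * x⁻¹ ≠ t ^ p.val * c ^ q.val := by
  intro h
  obtain ⟨q', hq'⟩ := conj_inv_word (x := x) hcc hcen hconj p q
  apply hg p q'
  rw [← hq', ← h]; group

/-! ## §2 The normal form -/

variable [Finite G]

/-- **Normal form of family CA2.**  See the module docstring: the conclusion is the disjunction «data of family CA2-Id» ∨
«data of family CA2-Swap». [cite: Rotman1995, Ch. 5 and Ch. 7] -/
theorem pair_normal_form (hcard : Nat.card G = 32) {t c x : G} (hcc : c * c = 1) (hc1 : c ≠ 1)
    (hcen : ∀ g : G, c * g = g * c) (hxt : x * t * x⁻¹ = t * c)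
    (hconj : ∀ g : G, g * t * g⁻¹ = t ∨ g * t * g⁻¹ = t * c) (htt : t * t = 1) (ht1 : t ≠ 1) (htne : t ≠ c)
    (hN2 : ∀ m : G, m * t = t * m → m * m = 1 ∨ m * m = t ∨ m * m = c ∨ m * m = t * c) :
    (∃ (α₂ β₂ γ₂ e₅ : ZMod 2) (a b y : G), a * t = t * a ∧ b * t = t * b ∧ (∀ p q : ZMod 2, a ≠ t ^ p.val * c ^ q.val) ∧
      (∀ p q i : ZMod 2, b ≠ t ^ p.val * (c ^ q.val * a ^ i.val)) ∧ a * a = c ^ α₂.val ∧ b * b = c ^ β₂.val ∧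
      b * a = a * b * c ^ γ₂.val ∧ y * t = t * c * y ∧ y * a = a * y ∧ y * b = t ^ (γ₂ * e₅).val * b * y ∧
      y * y = a ^ e₅.val) ∨
    (∃ (α₁ α₂ γ₂ ε : ZMod 2) (a b y : G), a * t = t * a ∧ b * t = t * b ∧ (∀ p q : ZMod 2, a ≠ t ^ p.val * c ^ q.val) ∧
      (∀ p q i : ZMod 2, b ≠ t ^ p.val * (c ^ q.val * a ^ i.val)) ∧ a * a = t ^ α₁.val * c ^ α₂.val ∧
      b * b = t ^ α₁.val * c ^ (α₁ + α₂).val ∧ b * a = a * b * c ^ γ₂.val ∧ y * t = t * c * y ∧ y * a = b * y ∧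
      y * b = c ^ (γ₂ * ε).val * a * y ∧ y * y = a ^ ε.val * b ^ ε.val) := by
  classical
  have hv1 : (1 : ZMod 2).val = 1 := rfl
  have htc : t * c = c * t := (hcen t).symm
  have hxxt : x * x * t = t * (x * x) := sq_comm_of_conj hcc hcen hxt
  -- choose `a ∈ C(t) ∖ N` with `x² ∈ N ∪ {a}`
  obtain ⟨a, hat, ha, hax⟩ : ∃ a : G, a * t = t * a ∧ (∀ p q : ZMod 2, a ≠ t ^ p.val * c ^ q.val) ∧
      ((∃ p q : ZMod 2, x * x = t ^ p.val * c ^ q.val) ∨ x * x = a) := by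
    by_cases hx2 : ∃ p q : ZMod 2, x * x = t ^ p.val * c ^ q.val
    · obtain ⟨a, hat, ha⟩ := exists_not_mem_N hcard hc1 hxt hconj
      exact ⟨a, hat, ha, Or.inl hx2⟩
    · push Not at hx2
      exact ⟨x * x, hxxt, hx2, Or.inr rfl⟩
  obtain ⟨b, hbt, hb⟩ := exists_not_mem_coset hcard a hc1 hxt hconj
  obtain ⟨α₁, α₂, β₁, β₂, γ₁, γ₂, p₁, q₁, e₁, e₂, p₂, q₂, e₃, e₄, p₃, q₃, e₅, e₆, haa, hbb, hba, hxa, hxb, hxx⟩ :=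
    exists_raw_bits hcard hcc hc1 hcen hxt hconj htt ht1 htne hN2 hat hbt ha hb
  have hinj := words_injective_pair htt hcc htc ht1 htne hc1 hat (hcen a).symm haa ha hb
  have hxa' : x * a * x⁻¹ = t ^ p₁.val * c ^ q₁.val * a ^ e₁.val * b ^ e₂.val := by rw [hxa]; group
  have hxb' : x * b * x⁻¹ = t ^ p₂.val * c ^ q₂.val * a ^ e₃.val * b ^ e₄.val := by rw [hxb]; group
  -- word equalities to bit equalities
  have hbits : ∀ p q i j p' q' i' j' : ZMod 2,
      t ^ p.val * c ^ q.val * a ^ i.val * b ^ j.val = t ^ p'.val * c ^ q'.val * a ^ i'.val * b ^ j'.val →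
      p = p' ∧ q = q' ∧ i = i' ∧ j = j' := by
    intro p q i j p' q' i' j' h
    have h2 := @hinj (p, q, i, j) (p', q', i', j') h
    simpa only [Prod.mk.injEq] using h2
  -- `e₆ = 0`
  have he₆ : e₆ = 0 := by
    rcases hax with ⟨p, q, h⟩ | h
    · rw [hxx] at h
      exact (hbits p₃ q₃ e₅ e₆ p q 0 0 (by rw [h, ZMod.val_zero, pow_zero, pow_zero, mul_one, mul_one])).2.2.2
    · rw [hxx] at h
      exact (hbits p₃ q₃ e₅ e₆ 0 0 1 0
        (by rw [h, ZMod.val_zero, hv1, pow_zero, pow_zero, pow_one, pow_zero, one_mul, one_mul, mul_one])).2.2.2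
  subst he₆
  rw [ZMod.val_zero, pow_zero, mul_one] at hxx
  -- `θ(a), θ(b) ∉ N`
  have hθaN : ¬ (e₁ = 0 ∧ e₂ = 0) := by
    rintro ⟨rfl, rfl⟩
    rw [ZMod.val_zero, pow_zero, pow_zero, mul_one, mul_one] at hxa'
    exact conj_not_word hcc hcen hconj ha p₁ q₁ hxa'
  have hbN : ∀ p q : ZMod 2, b ≠ t ^ p.val * c ^ q.val := fun p q h =>
    hb p q 0 (by rw [ZMod.val_zero, pow_zero, mul_one]; exact h)
  have hθbN : ¬ (e₃ = 0 ∧ e₄ = 0) := by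
    rintro ⟨rfl, rfl⟩
    rw [ZMod.val_zero, pow_zero, pow_zero, mul_one, mul_one] at hxb'
    exact conj_not_word hcc hcen hconj hbN p₂ q₂ hxb'
  by_cases hID : e₁ = 1 ∧ e₂ = 0 ∧ e₃ = 0 ∧ e₄ = 1
  · -- family CA2-Id
    left
    obtain ⟨rfl, rfl, rfl, rfl⟩ := hID
    rw [hv1, ZMod.val_zero, pow_one, pow_zero, mul_one] at hxa
    rw [hv1, ZMod.val_zero, pow_zero, pow_one, mul_one] at hxb
    obtain ⟨a', b', y, hat', hbt', ha', hb', haa', hbb', hba', hyt, hya, hyb, hyy⟩ :=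
      id_reduce hcc hc1 hcen htt hxt hat hbt ha hb haa hbb hba hxa hxb hxx
    exact ⟨α₂, β₂, γ₂, e₅, a', b', y, hat', hbt', ha', hb', haa', hbb', hba', by rw [← hyt]; group, hya, hyb, hyy⟩
  · -- family CA2-Swap: pick `a' ∈ {a, b}` moved by `θ̄`, `b' = x a' x⁻¹`
    right
    by_cases hA : e₁ = 1 ∧ e₂ = 0
    · -- `θ̄` fixes `ā`: then it moves `b̄`; new basis `(b, x b x⁻¹)`
      obtain ⟨rfl, rfl⟩ := hA
      have he₃ : e₃ = 1 := by
        rcases zmod2_cases e₃ with h | h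
        · exfalso
          rcases zmod2_cases e₄ with h4 | h4
          · exact hθbN ⟨h, h4⟩
          · exact hID ⟨rfl, rfl, h, h4⟩
        · exact h
      subst he₃
      -- `b' = x b x⁻¹ ∉ N ∪ N b`
      have hb't : (x * b * x⁻¹) * t = t * (x * b * x⁻¹) := conj_comm_of_comm hcen hconj hbt
      have hb'N : ∀ p q i : ZMod 2, x * b * x⁻¹ ≠ t ^ p.val * (c ^ q.val * b ^ i.val) := by
        intro p q i h
        rw [hxb'] at h
        have := (hbits p₂ q₂ 1 e₄ p q 0 i (by rw [h, ZMod.val_zero, pow_zero, mul_one, ← mul_assoc])).2.2.1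
        exact absurd this (by decide)
      obtain ⟨α₁', α₂', -, -, γ₁', γ₂', -, -, -, -, p₂', q₂', e₃', e₄', p₃', q₃', e₅', e₆', haa', -, hba', -, hxb'', hxx'⟩ :=
        exists_raw_bits hcard hcc hc1 hcen hxt hconj htt ht1 htne hN2 hbt hb't hbN hb'N
      obtain ⟨y, hyt, hbb', hba'', hya, hyb, hyy⟩ := swap_reduce hcc hc1 hcen htt ht1 htne hxt hbt hb't hbN hb'N haa' hba'
        (by group) hxb'' hxx'
      exact ⟨α₁', α₂', γ₂', e₅', b, x * b * x⁻¹, y, hbt, hb't, hbN, hb'N, haa', hbb', hba'', by rw [← hyt]; group,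
        hya, hyb, hyy⟩
    · -- `θ̄` moves `ā`: new basis `(a, x a x⁻¹)`
      have he₂ : e₂ = 1 := by
        rcases zmod2_cases e₂ with h | h
        · exfalso
          rcases zmod2_cases e₁ with h1 | h1
          · exact hθaN ⟨h1, h⟩
          · exact hA ⟨h1, h⟩
        · exact h
      subst he₂
      have ha't : (x * a * x⁻¹) * t = t * (x * a * x⁻¹) := conj_comm_of_comm hcen hconj hat
      have ha'N : ∀ p q i : ZMod 2, x * a * x⁻¹ ≠ t ^ p.val * (c ^ q.val * a ^ i.val) := by
        intro p q i h
        rw [hxa'] at h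
        have := (hbits p₁ q₁ e₁ 1 p q i 0 (by rw [h, ZMod.val_zero, pow_zero, mul_one, ← mul_assoc])).2.2.2
        exact absurd this (by decide)
      obtain ⟨α₁', α₂', -, -, γ₁', γ₂', -, -, -, -, p₂', q₂', e₃', e₄', p₃', q₃', e₅', e₆', haa', -, hba', -, hxb'', hxx'⟩ :=
        exists_raw_bits hcard hcc hc1 hcen hxt hconj htt ht1 htne hN2 hat ha't ha ha'N
      obtain ⟨y, hyt, hbb', hba'', hya, hyb, hyy⟩ := swap_reduce hcc hc1 hcen htt ht1 htne hxt hat ha't ha ha'N haa' hba'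
        (by group) hxb'' hxx'
      exact ⟨α₁', α₂', γ₂', e₅', a, x * a * x⁻¹, y, hat, ha't, ha, ha'N, haa', hbb', hba'', by rw [← hyt]; group,
        hya, hyb, hyy⟩

end Summit.HodgeConjecture.CorCM.GaloisModels.CaseA
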